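import Mathlib

/-!
# Route OverlapGapAlgebra, crux `SearchHardWindow` (stmt-PneNP-2460): the splice path over an
# ARBITRARY symbol alphabet is the lexicographic walk with `k` sweeps

Verbatim generalisation of `stub_pathIsWalk`
(`…SolvableImpliesStableSectionPathIsWalk.lean`, line `Sketch` of crux stmt-PneNP-2463, prover of
that line) from the literal alphabet `Fin n × Bool` to an arbitrary symbol type `S`: for path tuples
`Ψ : Fin (k+1) → (Fin m → Fin k → S)` the splice point `(r, q)` (slot `(a, b)` read from `Ψ (r+1)` iff
`a·k + b < q`) is the position at time `r·(m k) + q` of the coordinate-resampling walk on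
`Fin m × Fin k → S` with direction schedule `σ t = slot (t mod mk)`, under an explicit bijection
`e : Ψ ↦ (start, fresh symbols)`; every slot is resampled exactly `k` times. The proofs are index
arithmetic and never inspect the alphabet, so they are copied with `Fin n × Bool` replaced by `S`
(`-- adapted from …PathIsWalk.lean`).

Use (this seat's macro-step line on stmt-PneNP-2460, `…BlockPaths.lean`): with the BLOCK alphabet
`S := Fin L → Fin n × Bool` (a symbol = the `L` literals of one block) the same walk is the
Bresler–Huang path read at the checkpoints `q = i·L` only, which is where the scan correlation
inequality `scc_count` is applied to get vanishing (not just non-saturating) low-degree success.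

References: G. Bresler, B. Huang, FOCS 2021 / arXiv:2106.02129, Def. 4.2 [BreslerHuang2022].
-/

-- adapted from Summits/PneNP/PneNP/Theorems/OverlapGapAlgebraSolvableImpliesStableSectionPathIsWalk.lean

set_option linter.dupNamespace false

namespace Summit.PneNP.PneNP.Theorems

open Finset
open scoped Classical

/-- Index bound: `r < k` and `q < M` give `r·M + q < k·M`. -/
private theorem bpw_time_lt {k M r q : ℕ} (hr : r < k) (hq : q < M) : r * M + q < k * M :=
  calc r * M + q < r * M + M := by omega
    _ = (r + 1) * M := by ring
    _ ≤ k * M := Nat.mul_le_mul_right M hr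

/-- Index bound: `t < k·(m·k)` gives `t / (m·k) < k`. -/
private theorem bpw_div_lt {k m t : ℕ} (ht : t < k * (m * k)) : t / (m * k) < k :=
  Nat.div_lt_of_lt_mul (by rwa [Nat.mul_comm] at ht)

/-- `(r·M + s) / M = r` for `s < M`. -/
private theorem bpw_div_eq {M r s : ℕ} (hs : s < M) : (r * M + s) / M = r := by
  rw [Nat.add_comm, Nat.add_mul_div_right _ _ (by omega), Nat.div_eq_of_lt hs, Nat.zero_add]

/-- `(r·M + s) mod M = s` for `s < M`. -/
private theorem bpw_mod_eq {M r s : ℕ} (hs : s < M) : (r * M + s) % M = s :=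
  Nat.mul_add_mod_of_lt hs

/-- Evaluating a path tuple at indices with equal values gives equal results. -/
private theorem bpw_congr {k m : ℕ} {S : Type*} (Ψ : Fin (k + 1) → Fin m → Fin k → S)
    {i i' : Fin (k + 1)} {a a' : Fin m} {b b' : Fin k}
    (hi : (i : ℕ) = i') (ha : (a : ℕ) = a') (hb : (b : ℕ) = b') : Ψ i a b = Ψ i' a' b' := by
  rw [Fin.ext hi, Fin.ext ha, Fin.ext hb]

/-- The direction at a time `t = r·(mk) + s`, `s < mk`, is the slot `(s / k, s mod k)`. -/
private theorem bpw_sigma_at {k m : ℕ} (σ : Fin (k * (m * k)) → Fin m × Fin k)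
    (hσ : ∀ t, ((σ t).1 : ℕ) = (t : ℕ) % (m * k) / k ∧ ((σ t).2 : ℕ) = (t : ℕ) % (m * k) % k)
    (t : Fin (k * (m * k))) {r s : ℕ} (ht : (t : ℕ) = r * (m * k) + s) (hs : s < m * k) :
    ((σ t).1 : ℕ) = s / k ∧ ((σ t).2 : ℕ) = s % k := by
  obtain ⟨h1, h2⟩ := hσ t
  rw [h1, h2, ht, bpw_mod_eq hs]
  exact ⟨rfl, rfl⟩

/-- The direction at the time `t = r·(mk) + (a·k + b)`, `a < m`, `b < k`, is the slot `(a, b)`. -/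
private theorem bpw_sigma_slot {k m : ℕ} (σ : Fin (k * (m * k)) → Fin m × Fin k)
    (hσ : ∀ t, ((σ t).1 : ℕ) = (t : ℕ) % (m * k) / k ∧ ((σ t).2 : ℕ) = (t : ℕ) % (m * k) % k)
    (t : Fin (k * (m * k))) {r a b : ℕ} (ht : (t : ℕ) = r * (m * k) + (a * k + b))
    (ha : a < m) (hb : b < k) : ((σ t).1 : ℕ) = a ∧ ((σ t).2 : ℕ) = b := by
  obtain ⟨h1, h2⟩ := bpw_sigma_at σ hσ t ht (bpw_time_lt ha hb)
  rw [h1, h2, bpw_div_eq hb, bpw_mod_eq hb]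
  exact ⟨rfl, rfl⟩

/-- Fibres of the direction schedule: `σ t = j ↔ t mod (mk) = j.1·k + j.2`. -/
private theorem bpw_sigma_eq_iff {k m : ℕ} (σ : Fin (k * (m * k)) → Fin m × Fin k)
    (hσ : ∀ t, ((σ t).1 : ℕ) = (t : ℕ) % (m * k) / k ∧ ((σ t).2 : ℕ) = (t : ℕ) % (m * k) % k)
    (t : Fin (k * (m * k))) (j : Fin m × Fin k) :
    σ t = j ↔ (t : ℕ) % (m * k) = (j.1 : ℕ) * k + j.2 := by
  obtain ⟨h1, h2⟩ := hσ t
  constructor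
  · rintro rfl
    rw [h1, h2, Nat.div_add_mod']
  · intro h
    refine Prod.ext (Fin.ext ?_) (Fin.ext ?_)
    · rw [h1, h, bpw_div_eq j.2.isLt]
    · rw [h2, h, bpw_mod_eq j.2.isLt]

/-- Residue classes: for `c < mk`, exactly `k` of the times `t < k·(mk)` have `t mod (mk) = c`,
namely `t = i·(mk) + c`, `i < k`. -/
private theorem bpw_card_fibre {k m c : ℕ} (hc : c < m * k) :
    ((univ : Finset (Fin (k * (m * k)))).filter
      fun t : Fin (k * (m * k)) => (t : ℕ) % (m * k) = c).card = k := by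
  have himage : ((univ : Finset (Fin (k * (m * k)))).filter
      fun t : Fin (k * (m * k)) => (t : ℕ) % (m * k) = c) =
      (univ : Finset (Fin k)).image
        fun i : Fin k => (⟨(i : ℕ) * (m * k) + c, bpw_time_lt i.isLt hc⟩ : Fin (k * (m * k))) := by
    ext t
    simp only [mem_filter, mem_univ, true_and, mem_image]
    constructor
    · intro h
      refine ⟨⟨(t : ℕ) / (m * k), bpw_div_lt t.isLt⟩, Fin.ext ?_⟩
      have hdm := Nat.div_add_mod' (t : ℕ) (m * k)
      rw [h] at hdm
      exact hdm
    · rintro ⟨i, rfl⟩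
      exact bpw_mod_eq hc
  rw [himage, card_image_of_injective _ fun i i' h => ?_, card_univ, Fintype.card_fin]
  have hv := Fin.mk.inj_iff.mp h
  exact Fin.ext (Nat.eq_of_mul_eq_mul_right (by omega) (Nat.add_right_cancel hv))

/-- One sweep of the walk: if at time `r·(mk)` every slot reads `Ψ r`, then at time `r·(mk) + q`,
`q ≤ mk`, slot `(a, b)` reads `Ψ (r+1)` if `a·k + b < q` and `Ψ r` otherwise. -/
private theorem bpw_sweep {k m : ℕ} {S : Type*} (σ : Fin (k * (m * k)) → Fin m × Fin k)
    (hσ : ∀ t, ((σ t).1 : ℕ) = (t : ℕ) % (m * k) / k ∧ ((σ t).2 : ℕ) = (t : ℕ) % (m * k) % k)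
    (pos : (Fin m × Fin k → S) → (Fin (k * (m * k)) → S) → ℕ →
      (Fin m × Fin k → S))
    (hposS : ∀ v U (t : Fin (k * (m * k))),
      pos v U ((t : ℕ) + 1) = Function.update (pos v U t) (σ t) (U t))
    (Ψ : Fin (k + 1) → Fin m → Fin k → S)
    (v : Fin m × Fin k → S) (U : Fin (k * (m * k)) → S)
    (hU : ∀ t, U t = Ψ (Fin.succ ⟨(t : ℕ) / (m * k), bpw_div_lt t.isLt⟩) (σ t).1 (σ t).2)
    (r : ℕ) (hr : r < k) (hstart : ∀ ab, pos v U (r * (m * k)) ab = Ψ ⟨r, by omega⟩ ab.1 ab.2) :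
    ∀ q, q ≤ m * k → ∀ ab : Fin m × Fin k, pos v U (r * (m * k) + q) ab =
      if (ab.1 : ℕ) * k + ab.2 < q then Ψ ⟨r + 1, by omega⟩ ab.1 ab.2
        else Ψ ⟨r, by omega⟩ ab.1 ab.2 := by
  intro q
  induction q with
  | zero =>
    intro _ ab
    simp [hstart]
  | succ q ih =>
    intro hq ab
    have hq' : q < m * k := hq
    have ht : r * (m * k) + q < k * (m * k) := bpw_time_lt hr hq'
    have hσt := bpw_sigma_at σ hσ ⟨r * (m * k) + q, ht⟩ rfl hq'
    rw [← Nat.add_assoc, hposS v U ⟨r * (m * k) + q, ht⟩]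
    by_cases hab : ab = σ ⟨r * (m * k) + q, ht⟩
    · subst hab
      rw [Function.update_self, hU]
      have hlt : ((σ ⟨r * (m * k) + q, ht⟩).1 : ℕ) * k + (σ ⟨r * (m * k) + q, ht⟩).2 < q + 1 := by
        rw [hσt.1, hσt.2, Nat.div_add_mod']
        exact Nat.lt_succ_self q
      rw [if_pos hlt]
      exact bpw_congr Ψ (by simp [bpw_div_eq hq']) rfl rfl
    · rw [Function.update_of_ne hab, ih hq'.le ab]
      have hne : (ab.1 : ℕ) * k + ab.2 ≠ q := by
        intro h
        apply hab
        refine Prod.ext (Fin.ext ?_) (Fin.ext ?_)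
        · rw [hσt.1, ← h, bpw_div_eq ab.2.isLt]
        · rw [hσt.2, ← h, bpw_mod_eq ab.2.isLt]
      by_cases hlt : (ab.1 : ℕ) * k + ab.2 < q
      · rw [if_pos hlt, if_pos (Nat.lt_succ_of_lt hlt)]
      · rw [if_neg hlt, if_neg (by omega)]

/-- Sweep starts: at time `r·(mk)`, `r < k`, every slot of the walk reads `Ψ r`. -/
private theorem bpw_start {k m : ℕ} {S : Type*} (σ : Fin (k * (m * k)) → Fin m × Fin k)
    (hσ : ∀ t, ((σ t).1 : ℕ) = (t : ℕ) % (m * k) / k ∧ ((σ t).2 : ℕ) = (t : ℕ) % (m * k) % k)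
    (pos : (Fin m × Fin k → S) → (Fin (k * (m * k)) → S) → ℕ →
      (Fin m × Fin k → S))
    (hpos0 : ∀ v U, pos v U 0 = v)
    (hposS : ∀ v U (t : Fin (k * (m * k))),
      pos v U ((t : ℕ) + 1) = Function.update (pos v U t) (σ t) (U t))
    (Ψ : Fin (k + 1) → Fin m → Fin k → S)
    (v : Fin m × Fin k → S) (U : Fin (k * (m * k)) → S)
    (hv : ∀ ab, v ab = Ψ 0 ab.1 ab.2)
    (hU : ∀ t, U t = Ψ (Fin.succ ⟨(t : ℕ) / (m * k), bpw_div_lt t.isLt⟩) (σ t).1 (σ t).2) :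
    ∀ r (hr : r < k) (ab : Fin m × Fin k),
      pos v U (r * (m * k)) ab = Ψ ⟨r, by omega⟩ ab.1 ab.2 := by
  intro r
  induction r with
  | zero =>
    intro _ ab
    rw [Nat.zero_mul, hpos0, hv]
    rfl
  | succ r ih =>
    intro hr ab
    have hr' : r < k := Nat.lt_of_succ_lt hr
    have h := bpw_sweep σ hσ pos hposS Ψ v U hU r hr' (ih hr') (m * k) le_rfl ab
    rw [show (r + 1) * (m * k) = r * (m * k) + m * k by ring, h,
      if_pos (bpw_time_lt ab.1.isLt ab.2.isLt)]

/-- **Stub 5 — the crux's splice path IS the lazy lexicographic walk with `k` sweeps.**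
For the direction schedule `σ t = slot (t mod mk)` (clause `(t mod mk)/k`, position
`(t mod mk) mod k`) and any realisation `pos` of the walk, there is a bijection `e` between path
tuples `Ψ : Fin (k+1) → instances` and pairs (start `v` = `Ψ 0` uncurried, fresh symbols
`U t = Ψ (t/(mk) + 1) (slot (t mod mk))`) under which the splice point `(r, q)`, `q ≤ mk`, is the
walk's position at time `r·mk + q`; and every slot is resampled exactly `k` times. Index arithmetic:
residue classes mod `mk` for the fibre count, `t = (t/(mk))·(mk) + t mod (mk)` for the two round
trips of `e`, and a double induction (on the sweep `r`, then on `q`) for the walk identity. -/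
theorem blk_pathIsWalk {S : Type*} (k m : ℕ) (σ : Fin (k * (m * k)) → Fin m × Fin k)
    (hσ : ∀ t, ((σ t).1 : ℕ) = (t : ℕ) % (m * k) / k ∧ ((σ t).2 : ℕ) = (t : ℕ) % (m * k) % k)
    (pos : (Fin m × Fin k → S) → (Fin (k * (m * k)) → S) → ℕ →
      (Fin m × Fin k → S))
    (hpos0 : ∀ v U, pos v U 0 = v)
    (hposS : ∀ v U (t : Fin (k * (m * k))),
      pos v U ((t : ℕ) + 1) = Function.update (pos v U t) (σ t) (U t)) :
    (∀ j : Fin m × Fin k, ((univ : Finset (Fin (k * (m * k)))).filter fun t => σ t = j).card = k) ∧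
    ∃ e : (Fin (k + 1) → Fin m → Fin k → S) ≃
        ((Fin m × Fin k → S) × (Fin (k * (m * k)) → S)),
      ∀ (Ψ : Fin (k + 1) → Fin m → Fin k → S) (r : Fin k) (q : ℕ), q ≤ m * k →
        ∀ (a : Fin m) (b : Fin k),
          (if (a : ℕ) * k + b < q then Ψ r.succ a b else Ψ r.castSucc a b)
            = pos (e Ψ).1 (e Ψ).2 ((r : ℕ) * (m * k) + q) (a, b) := by
  refine ⟨fun j => ?_, ?_⟩
  · -- (1) every slot is the direction of exactly `k` steps
    rw [filter_congr fun t _ => bpw_sigma_eq_iff σ hσ t j]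
    exact bpw_card_fibre (bpw_time_lt j.1.isLt j.2.isLt)
  · -- (2) the bijection `e` and the walk identity
    refine ⟨{ toFun := fun Ψ => (Function.uncurry (Ψ 0),
                fun t => Ψ (Fin.succ ⟨(t : ℕ) / (m * k), bpw_div_lt t.isLt⟩) (σ t).1 (σ t).2)
              invFun := fun vU => Fin.cons (Function.curry vU.1) fun r a b =>
                vU.2 ⟨(r : ℕ) * (m * k) + ((a : ℕ) * k + b),
                  bpw_time_lt r.isLt (bpw_time_lt a.isLt b.isLt)⟩
              left_inv := fun Ψ => ?_
              right_inv := fun vU => ?_ }, fun Ψ r q hq a b => ?_⟩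
    · -- `e.symm (e Ψ) = Ψ`
      funext i
      refine Fin.cases ?_ (fun r => ?_) i
      · simp only [Fin.cons_zero, Function.curry_uncurry]
      · simp only [Fin.cons_succ]
        funext a b
        obtain ⟨ha, hb⟩ := bpw_sigma_slot σ hσ
          ⟨(r : ℕ) * (m * k) + ((a : ℕ) * k + b), bpw_time_lt r.isLt (bpw_time_lt a.isLt b.isLt)⟩
          rfl a.isLt b.isLt
        exact bpw_congr Ψ (by simp [bpw_div_eq (bpw_time_lt a.isLt b.isLt)]) ha hb
    · -- `e (e.symm (v, U)) = (v, U)`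
      obtain ⟨v, U⟩ := vU
      simp only [Fin.cons_zero, Fin.cons_succ, Function.uncurry_curry, Prod.mk.injEq, true_and]
      funext t
      refine congrArg U (Fin.ext ?_)
      obtain ⟨h1, h2⟩ := hσ t
      rw [Fin.val_mk, h1, h2, Nat.div_add_mod', Nat.div_add_mod']
    · -- the splice point `(r, q)` is the walk's position at time `r·(mk) + q`
      exact (bpw_sweep σ hσ pos hposS Ψ _ _ (fun _ => rfl) r r.isLt
        (bpw_start σ hσ pos hpos0 hposS Ψ _ _ (fun _ => rfl) (fun _ => rfl) r r.isLt)
        q hq (a, b)).symm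

end Summit.PneNP.PneNP.Theorems
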